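import Literature.Geometry.Lorentzian.CausalityPushUp
import Literature.Geometry.Lorentzian.CausalityClosedProofs

/-!
# Route SwallowTheDatum · item `SubdataDevelopmentsEmbed` (stmt-FinalStateConjecture-10053) —
# towards the domain of dependence of the sub-datum (`hcauchy`), II: the causal trichotomy of a
# Cauchy hypersurface and the soft properties of the timelike domain of dependence

For a Cauchy hypersurface `Σ` (a set met exactly once by every endless timelike curve) of a
time-oriented Lorentzian manifold (Hausdorff, second countable, without boundary, finite
dimension, `C²`), O'Neill's Lemma 14.29: `M = I⁻(Σ) ⊔ Σ ⊔ I⁺(Σ)` (`mem_chronologicalFuture_or_mem_chronologicalPast`,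
and the three pairwise disjointness statements, from achronality
`IsCauchyHypersurface.isAchronal_holds` and transitivity of `≪`); the futures of `I⁺(Σ)` stay in
`I⁺(Σ)`; and **separation**: a future timelike curve segment from `I⁻(Σ) ∪ Σ` to `I⁺(Σ) ∪ Σ`
meets `Σ` (`exists_mem_of_isFutureTimelikeCurveOn`, connectedness of `[a, b]`).

The **timelike domain of dependence** of `S ⊆ M` is used in the displayed form
`∀ γ s, IsEndlessTimelikeCurve γ s → ∀ t₀ ∈ s, γ t₀ = p → ∃ t ∈ s, γ t ∈ S` ("every endless timelike
curve through `p` meets `S`"; Hawking–Ellis 1973, §6.5, `D̃(S)`). For `S ⊆ Σ` its soft properties: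
a point of `Σ` in it lies in `S` (`mem_of_mem_of_forall_endless`); a point `σ ∈ Σ` in the
chronological past or future of a point of it lies in `S`; and it is "causally convex towards
`Σ`": a point of `I⁺(Σ)` in the chronological past of a point of it belongs to it
(`forall_endless_of_mem_chronologicalPast`), and dually.

No definition, no named fact.
-/

noncomputable section

open Function Set Filter Topology TopologicalSpace Bundle Manifold
open scoped Manifold ContDiff Topology

namespace Summit.FinalStateConjecture.FinalStateConjecture.Theorems

namespace SubdataDevelopmentsEmbed

open Literature.Geometry.Lorentzian

section Causal

variable {E : Type*} [NormedAddCommGroup E] [NormedSpace ℝ E] {H : Type*} [TopologicalSpace H]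
  {I : ModelWithCorners ℝ E H} {n : ℕ∞ω} {M : Type*} [TopologicalSpace M] [ChartedSpace H M]
  [IsManifold I ∞ M] {g : LorentzianMetric I n M} {τ : TimeOrientation g}
  [T2Space M] [SecondCountableTopology M] [BoundarylessManifold I M] [FiniteDimensional ℝ E]

/-! ### The causal trichotomy of a Cauchy hypersurface (O'Neill 14.29) -/

/-- **A point off a Cauchy hypersurface lies in its chronological future or past** (the endless
timelike curve through the point meets `Σ` before or after it). O'Neill 1983, Ch. 14, Lemma
14.29 ("`M` is the disjoint union of `I⁻(S)`, `S`, `I⁺(S)`"). -/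
theorem mem_chronologicalFuture_or_mem_chronologicalPast (hn : 2 ≤ n) {Sig : Set M}
    (hSig : g.IsCauchyHypersurface τ Sig) {p : M} (hp : p ∉ Sig) :
    p ∈ g.chronologicalFuture τ Sig ∨ p ∈ g.chronologicalPast τ Sig := by
  obtain ⟨Δ, D, hΔ, h0D, hΔ0⟩ :=
    LorentzianMetric.exists_isEndlessTimelikeCurve_through (g := g) (τ := τ) hn p
  obtain ⟨t₁, ⟨ht₁D, ht₁S⟩, -⟩ := hSig Δ D hΔ
  rcases lt_trichotomy t₁ 0 with ht | rfl | ht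
  · exact Or.inl ⟨Δ t₁, ht₁S, Δ, t₁, 0, ht, hΔ.2.1.mono (hΔ.1.out ht₁D h0D), rfl, hΔ0⟩
  · rw [hΔ0] at ht₁S
    exact absurd ht₁S hp
  · have hseg : g.IsFutureTimelikeCurveOn τ Δ (Icc 0 t₁) := hΔ.2.1.mono (hΔ.1.out h0D ht₁D)
    refine Or.inr ⟨Δ t₁, ht₁S, fun t ↦ Δ (0 + t₁ - t), 0, t₁, ht, hseg.reverseParam, ?_, ?_⟩
    · simp
    · simp [hΔ0]

/-- A point of `I⁺(Σ)` is not on `Σ` (achronality). O'Neill 1983, Ch. 14, Lemma 14.29. -/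
theorem not_mem_of_mem_chronologicalFuture (hn : 2 ≤ n) {Sig : Set M}
    (hSig : g.IsCauchyHypersurface τ Sig) {p : M} (hp : p ∈ g.chronologicalFuture τ Sig) :
    p ∉ Sig := fun hpSig ↦ by
  obtain ⟨q, hq, hpq⟩ := hp
  exact LorentzianMetric.IsCauchyHypersurface.isAchronal_holds hn hSig q hq p hpSig ⟨q, rfl, hpq⟩

/-- A point of `I⁻(Σ)` is not on `Σ` (achronality). O'Neill 1983, Ch. 14, Lemma 14.29. -/
theorem not_mem_of_mem_chronologicalPast (hn : 2 ≤ n) {Sig : Set M}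
    (hSig : g.IsCauchyHypersurface τ Sig) {p : M} (hp : p ∈ g.chronologicalPast τ Sig) :
    p ∉ Sig := fun hpSig ↦ by
  obtain ⟨q, hq, hpq⟩ := hp
  have hqp : q ∈ g.chronologicalFuture τ {p} :=
    LorentzianMetric.mem_chronologicalFuture_of_mem_chronologicalPast ⟨q, rfl, hpq⟩
  exact LorentzianMetric.IsCauchyHypersurface.isAchronal_holds hn hSig p hpSig q hq hqp

/-- `I⁺(Σ)` and `I⁻(Σ)` are disjoint (a point in both gives two chronologically related points of
`Σ`, by transitivity of `≪`). O'Neill 1983, Ch. 14, Lemma 14.29. -/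
theorem not_mem_chronologicalPast_of_mem_chronologicalFuture (hn : 2 ≤ n) {Sig : Set M}
    (hSig : g.IsCauchyHypersurface τ Sig) {p : M} (hp : p ∈ g.chronologicalFuture τ Sig) :
    p ∉ g.chronologicalPast τ Sig := fun hp' ↦ by
  obtain ⟨q₁, hq₁, hpq₁⟩ := hp
  obtain ⟨q₂, hq₂, hpq₂⟩ := hp'
  have h₂ : q₂ ∈ g.chronologicalFuture τ {p} :=
    LorentzianMetric.mem_chronologicalFuture_of_mem_chronologicalPast ⟨q₂, rfl, hpq₂⟩
  have h : q₂ ∈ g.chronologicalFuture τ {q₁} :=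
    LorentzianMetric.mem_chronologicalFuture_trans ⟨q₁, rfl, hpq₁⟩ h₂
  exact LorentzianMetric.IsCauchyHypersurface.isAchronal_holds hn hSig q₁ hq₁ q₂ hq₂ h

/-! ### Separation -/

/-- **A future timelike curve segment from `I⁻(Σ) ∪ Σ` to `I⁺(Σ) ∪ Σ` meets `Σ`.** If `β` is a
future timelike curve on `[a, b]`, `a ≤ b`, with `β a ∉ I⁺(Σ)` and `β b ∉ I⁻(Σ)`, then
`β t ∈ Σ` for some `t ∈ [a, b]`: otherwise the connected set `β([a, b])` lies in the union of the
disjoint open sets `I⁻(Σ)`, `I⁺(Σ)` (trichotomy), meeting both — impossible. -/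
theorem exists_mem_of_isFutureTimelikeCurveOn (hn : 2 ≤ n) {Sig : Set M}
    (hSig : g.IsCauchyHypersurface τ Sig) {β : ℝ → M} {a b : ℝ} (hab : a ≤ b)
    (hβ : g.IsFutureTimelikeCurveOn τ β (Icc a b)) (ha : β a ∉ g.chronologicalFuture τ Sig)
    (hb : β b ∉ g.chronologicalPast τ Sig) : ∃ t ∈ Icc a b, β t ∈ Sig := by
  by_contra hno
  push Not at hno
  have hcont : ContinuousOn β (Icc a b) := fun t ht ↦ (hβ t ht).1.continuousAt.continuousWithinAt
  have hpre : IsPreconnected (β '' Icc a b) := isPreconnected_Icc.image β hcont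
  have hsub : β '' Icc a b ⊆ g.chronologicalPast τ Sig ∪ g.chronologicalFuture τ Sig := by
    rintro _ ⟨t, ht, rfl⟩
    rcases mem_chronologicalFuture_or_mem_chronologicalPast hn hSig (hno t ht) with h | h
    · exact Or.inr h
    · exact Or.inl h
  have hdisj : Disjoint (g.chronologicalPast τ Sig) (g.chronologicalFuture τ Sig) :=
    Set.disjoint_left.2 fun p hp hp' ↦
      not_mem_chronologicalPast_of_mem_chronologicalFuture hn hSig hp' hp
  have haI : a ∈ Icc a b := left_mem_Icc.2 hab
  have hbI : b ∈ Icc a b := right_mem_Icc.2 hab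
  have ha' : β a ∈ g.chronologicalPast τ Sig :=
    (mem_chronologicalFuture_or_mem_chronologicalPast hn hSig (hno a haI)).resolve_left ha
  have hb' : β b ∈ g.chronologicalFuture τ Sig :=
    (mem_chronologicalFuture_or_mem_chronologicalPast hn hSig (hno b hbI)).resolve_right hb
  rcases hpre.subset_or_subset (LorentzianMetric.isOpen_chronologicalPast_of_boundaryless g τ Sig)
    (LorentzianMetric.isOpen_chronologicalFuture_of_boundaryless g τ Sig) hdisj hsub with h | h
  · exact not_mem_chronologicalPast_of_mem_chronologicalFuture hn hSig hb' (h ⟨b, hbI, rfl⟩)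
  · exact not_mem_chronologicalPast_of_mem_chronologicalFuture hn hSig (h ⟨a, haI, rfl⟩) ha'

omit [T2Space M] [SecondCountableTopology M] [BoundarylessManifold I M] [FiniteDimensional ℝ E] in
/-- **Points of a future timelike curve after a crossing of `Σ` lie in `I⁺(Σ)`, before it in
`I⁻(Σ)`** (the curve segment witnesses the chronological relation). -/
theorem mem_chronologicalFuture_of_lt {Sig : Set M} {γ : ℝ → M} {s : Set ℝ} (hs : s.OrdConnected)
    (hγ : g.IsFutureTimelikeCurveOn τ γ s) {t₁ t₂ : ℝ} (ht₁ : t₁ ∈ s) (ht₂ : t₂ ∈ s)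
    (h12 : t₁ < t₂) (hSig₁ : γ t₁ ∈ Sig) : γ t₂ ∈ g.chronologicalFuture τ Sig :=
  ⟨γ t₁, hSig₁, γ, t₁, t₂, h12, hγ.mono (hs.out ht₁ ht₂), rfl, rfl⟩

omit [T2Space M] [SecondCountableTopology M] [BoundarylessManifold I M] [FiniteDimensional ℝ E] in
/-- Time dual of `mem_chronologicalFuture_of_lt`. -/
theorem mem_chronologicalPast_of_lt {Sig : Set M} {γ : ℝ → M} {s : Set ℝ} (hs : s.OrdConnected)
    (hγ : g.IsFutureTimelikeCurveOn τ γ s) {t₁ t₂ : ℝ} (ht₁ : t₁ ∈ s) (ht₂ : t₂ ∈ s)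
    (h12 : t₁ < t₂) (hSig₂ : γ t₂ ∈ Sig) : γ t₁ ∈ g.chronologicalPast τ Sig := by
  refine ⟨γ t₂, hSig₂, fun t ↦ γ (t₁ + t₂ - t), t₁, t₂, h12,
    (hγ.mono (hs.out ht₁ ht₂)).reverseParam, ?_, ?_⟩
  · simp
  · simp

/-! ### Soft properties of the timelike domain of dependence of `S ⊆ Σ` -/

/-- **A point of `Σ` every endless timelike curve through which meets `S ⊆ Σ` lies in `S`**
(the endless timelike curve through the point meets `Σ` only there). -/
theorem mem_of_mem_of_forall_endless (hn : 2 ≤ n) {Sig S : Set M}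
    (hSig : g.IsCauchyHypersurface τ Sig) (hS : S ⊆ Sig) {p : M} (hpSig : p ∈ Sig)
    (hp : ∀ (γ : ℝ → M) (s : Set ℝ), g.IsEndlessTimelikeCurve τ γ s → ∀ t₀ ∈ s, γ t₀ = p →
      ∃ t ∈ s, γ t ∈ S) : p ∈ S := by
  obtain ⟨Δ, D, hΔ, h0D, hΔ0⟩ :=
    LorentzianMetric.exists_isEndlessTimelikeCurve_through (g := g) (τ := τ) hn p
  obtain ⟨t, htD, htS⟩ := hp Δ D hΔ 0 h0D hΔ0
  obtain ⟨t₁, -, huniq⟩ := hSig Δ D hΔ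
  have e₁ := huniq t ⟨htD, hS htS⟩
  have e₂ := huniq 0 ⟨h0D, by rw [hΔ0]; exact hpSig⟩
  rw [e₁.trans e₂.symm, hΔ0] at htS
  exact htS

/-- **A point `σ ∈ Σ` in the chronological past of a point of the timelike domain of dependence
of `S ⊆ Σ` lies in `S`**: the timelike segment from `σ` to `p` lies on an endless timelike curve
through both endpoints (`exists_isEndlessTimelikeCurve_extends`), which meets `S` and meets `Σ`
only at `σ`. -/
theorem mem_of_mem_chronologicalFuture_of_forall_endless (hn : 2 ≤ n) {Sig S : Set M}
    (hSig : g.IsCauchyHypersurface τ Sig) (hS : S ⊆ Sig) {σ p : M} (hσ : σ ∈ Sig)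
    (hσp : p ∈ g.chronologicalFuture τ {σ})
    (hp : ∀ (γ : ℝ → M) (s : Set ℝ), g.IsEndlessTimelikeCurve τ γ s → ∀ t₀ ∈ s, γ t₀ = p →
      ∃ t ∈ s, γ t ∈ S) : σ ∈ S := by
  obtain ⟨σ₀, hσ₀, β, a, b, hab, hβ, hβa, hβb⟩ := hσp
  rw [mem_singleton_iff] at hσ₀
  subst hσ₀
  obtain ⟨Δ, D, hΔ, haD, hbD, hΔa, hΔb⟩ :=
    LorentzianMetric.exists_isEndlessTimelikeCurve_extends (g := g) (τ := τ) hn hab hβ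
  obtain ⟨t, htD, htS⟩ := hp Δ D hΔ b hbD (by rw [hΔb, hβb])
  obtain ⟨t₁, -, huniq⟩ := hSig Δ D hΔ
  have e₁ := huniq t ⟨htD, hS htS⟩
  have e₂ := huniq a ⟨haD, by rw [hΔa, hβa]; exact hσ⟩
  rw [e₁.trans e₂.symm, hΔa, hβa] at htS
  exact htS

/-- Time dual: **a point `σ ∈ Σ` in the chronological future of a point of the timelike domain of
dependence of `S ⊆ Σ` lies in `S`.** -/
theorem mem_of_mem_chronologicalPast_of_forall_endless (hn : 2 ≤ n) {Sig S : Set M}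
    (hSig : g.IsCauchyHypersurface τ Sig) (hS : S ⊆ Sig) {σ p : M} (hσ : σ ∈ Sig)
    (hpσ : σ ∈ g.chronologicalFuture τ {p})
    (hp : ∀ (γ : ℝ → M) (s : Set ℝ), g.IsEndlessTimelikeCurve τ γ s → ∀ t₀ ∈ s, γ t₀ = p →
      ∃ t ∈ s, γ t ∈ S) : σ ∈ S := by
  obtain ⟨p₀, hp₀, β, a, b, hab, hβ, hβa, hβb⟩ := hpσ
  rw [mem_singleton_iff] at hp₀
  subst hp₀
  obtain ⟨Δ, D, hΔ, haD, hbD, hΔa, hΔb⟩ :=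
    LorentzianMetric.exists_isEndlessTimelikeCurve_extends (g := g) (τ := τ) hn hab hβ
  obtain ⟨t, htD, htS⟩ := hp Δ D hΔ a haD (by rw [hΔa, hβa])
  obtain ⟨t₁, -, huniq⟩ := hSig Δ D hΔ
  have e₁ := huniq t ⟨htD, hS htS⟩
  have e₂ := huniq b ⟨hbD, by rw [hΔb, hβb]; exact hσ⟩
  rw [e₁.trans e₂.symm, hΔb, hβb] at htS
  exact htS

/-- **Causal convexity towards `Σ`**: if every endless timelike curve through `p` meets `S ⊆ Σ`
and `e ∈ I⁺(Σ)` lies in the chronological past of `p`, then every endless timelike curve through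
`e` meets `S` — its crossing `σ'` of `Σ` occurs before `e` (`e ∈ I⁺(Σ)`), so `σ' ≪ e ≪ p` and
`σ' ∈ S` (`mem_of_mem_chronologicalFuture_of_forall_endless`). -/
theorem forall_endless_of_mem_chronologicalPast (hn : 2 ≤ n) {Sig S : Set M}
    (hSig : g.IsCauchyHypersurface τ Sig) (hS : S ⊆ Sig) {e p : M}
    (he : e ∈ g.chronologicalFuture τ Sig) (hep : p ∈ g.chronologicalFuture τ {e})
    (hp : ∀ (γ : ℝ → M) (s : Set ℝ), g.IsEndlessTimelikeCurve τ γ s → ∀ t₀ ∈ s, γ t₀ = p →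
      ∃ t ∈ s, γ t ∈ S) :
    ∀ (γ : ℝ → M) (s : Set ℝ), g.IsEndlessTimelikeCurve τ γ s → ∀ t₀ ∈ s, γ t₀ = e →
      ∃ t ∈ s, γ t ∈ S := by
  intro γ s hγ t₀ ht₀ hγt₀
  obtain ⟨t₁, ⟨ht₁s, ht₁Sig⟩, -⟩ := hSig γ s hγ
  refine ⟨t₁, ht₁s, ?_⟩
  rcases lt_trichotomy t₁ t₀ with hlt | rfl | hlt
  · -- the crossing is before `e`: `σ' ≪ e ≪ p`
    have hσe : e ∈ g.chronologicalFuture τ {γ t₁} := by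
      rw [← hγt₀]
      exact ⟨γ t₁, rfl, γ, t₁, t₀, hlt, hγ.2.1.mono (hγ.1.out ht₁s ht₀), rfl, rfl⟩
    exact mem_of_mem_chronologicalFuture_of_forall_endless hn hSig hS ht₁Sig
      (LorentzianMetric.mem_chronologicalFuture_trans hσe hep) hp
  · rw [hγt₀] at ht₁Sig
    exact absurd ht₁Sig (not_mem_of_mem_chronologicalFuture hn hSig he)
  · have h : e ∈ g.chronologicalPast τ Sig := by
      rw [← hγt₀]
      exact mem_chronologicalPast_of_lt hγ.1 hγ.2.1 ht₀ ht₁s hlt ht₁Sig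
    exact absurd h (not_mem_chronologicalPast_of_mem_chronologicalFuture hn hSig he)

/-- Time dual of `forall_endless_of_mem_chronologicalPast`: if every endless timelike curve
through `p` meets `S ⊆ Σ` and `e ∈ I⁻(Σ)` lies in the chronological future of `p`, then every
endless timelike curve through `e` meets `S`. -/
theorem forall_endless_of_mem_chronologicalFuture (hn : 2 ≤ n) {Sig S : Set M}
    (hSig : g.IsCauchyHypersurface τ Sig) (hS : S ⊆ Sig) {e p : M}
    (he : e ∈ g.chronologicalPast τ Sig) (hpe : e ∈ g.chronologicalFuture τ {p})
    (hp : ∀ (γ : ℝ → M) (s : Set ℝ), g.IsEndlessTimelikeCurve τ γ s → ∀ t₀ ∈ s, γ t₀ = p →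
      ∃ t ∈ s, γ t ∈ S) :
    ∀ (γ : ℝ → M) (s : Set ℝ), g.IsEndlessTimelikeCurve τ γ s → ∀ t₀ ∈ s, γ t₀ = e →
      ∃ t ∈ s, γ t ∈ S := by
  intro γ s hγ t₀ ht₀ hγt₀
  obtain ⟨t₁, ⟨ht₁s, ht₁Sig⟩, -⟩ := hSig γ s hγ
  refine ⟨t₁, ht₁s, ?_⟩
  rcases lt_trichotomy t₁ t₀ with hlt | rfl | hlt
  · have h : e ∈ g.chronologicalFuture τ Sig := by
      rw [← hγt₀]
      exact mem_chronologicalFuture_of_lt hγ.1 hγ.2.1 ht₁s ht₀ hlt ht₁Sig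
    exact absurd he (not_mem_chronologicalPast_of_mem_chronologicalFuture hn hSig h)
  · rw [hγt₀] at ht₁Sig
    exact absurd ht₁Sig (not_mem_of_mem_chronologicalPast hn hSig he)
  · -- the crossing is after `e`: `p ≪ e ≪ σ'`
    have heσ : γ t₁ ∈ g.chronologicalFuture τ {e} := by
      rw [← hγt₀]
      exact ⟨γ t₀, rfl, γ, t₀, t₁, hlt, hγ.2.1.mono (hγ.1.out ht₀ ht₁s), rfl, rfl⟩
    exact mem_of_mem_chronologicalPast_of_forall_endless hn hSig hS ht₁Sig
      (LorentzianMetric.mem_chronologicalFuture_trans hpe heσ) hp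

end Causal

end SubdataDevelopmentsEmbed

end Summit.FinalStateConjecture.FinalStateConjecture.Theorems

end
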